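import Summits.ResolutionOfSingularities.ResolutionOfSingularities.Theorems.PurelyInseparableDim4ResConeTwoSlotTransport
import HarnessLib
import HarnessLib.Audit.Tags

/-!
# Purely inseparable four-folds — TWO-SLOT GAME, ONE-STEP TRANSPORT (case S): the GENERAL relabeling identity of a
# slot step, read in the canonical jet frames (cell `res-dim4-pi`, K2(p) lane, slice B brick K24a, part R1c, file 1)

[OURS · counted 0 · cell `res-dim4-pi` · K2(p) lane (holder res-dim4-p-12; «p-1 takes K24a» 2026-08-29 01:14Z);
seat res-dim4-p-1 g4 over its own `…ResConeTwoSlotFramedStep` / `…ResConeTwoSlotTransport` (`slot_step_readings`)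
and res-dim4-p-1 g3's β5 `legal_readings_of_corner` / D4 `coeff_tsch_eq_of_frames`.]  Nothing here proves
K2(p)/K2(5), `NoIsolatedTrap p p` or resolution of singularities in dimension ≥ 4 / characteristic `p`.  AI kernel
work, weaker than expert review.

WHY.  `slot_step_readings` records three instances of the chart law between the framed readings of a slot step
(`x_κ²x_o³ ↦ x_κ²x_o³`, `x_κ³x_o² ↦ x_κ²x_o²`, `x_κ⁴x_o² ↦ x_κ³x_o²`).  The ROTATING two-slot game
(`…ResConeTwoSlotGameRotating`, hypotheses `hfix'`, `hmuT`) needs two more (`x_κx_o³ ↦ x_κx_o³`,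
`x_fx_κx_o² ↦ x_fx_κx_o²`); this file proves the chart law for EVERY relative exponent `m` with `3 ≤ |m|`,
`m_ν ≤ 3` and `|m♯| ≤ 6`, `m♯ := m` with `κ`-exponent replaced by `|m| − 3`, by the same route (framed step of
file 1, β5 straightness of the transported frame, D4 frame comparison for `N ≥ 7`).

* `slot_step_relabel` — `R′(m♯) = R(m)`;  `slot_step_relabel_fixed` — `R′(m) = R(m)` when `|m| = m_κ + 3`;
  the two named instances `slot_step_relabel_one_three`, `slot_step_relabel_f_one_two`.

[cite: CossartJannsenSaito2020, Thm. 3.14] [cite: HauserPerlega2019PRIMS, §2 (the blowup in the x₁-chart)]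
bears_on: LADDER-RESOLUTION:D157-DOOR2 (res-dim4-pi · K2(p) · slice B · K24a-R1c).  Supports
stmt-ResolutionOfSingularities-16155 (helper).
-/

set_option linter.dupNamespace false -- mandated namespace of this single-conjunct summit

noncomputable section

namespace Summit.ResolutionOfSingularities.ResolutionOfSingularities.Theorems.PIDim4

namespace ResCone

open MvPolynomial Finset FrameChange
open Literature.AlgebraicGeometry.Resolution
open Literature.AlgebraicGeometry.Resolution.CentreBlowup
open Literature.AlgebraicGeometry.Resolution.Hauser2010
open Literature.AlgebraicGeometry.Resolution.HauserPerlega2019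
open PointBlowup (translate)

variable {K : Type} [Field K]

section Relabel

variable [CharP K 5] [DecidableEq K]

/-- **THE CHART LAW BETWEEN CANONICAL FRAMES** (K24a-R1c).  Setting of `slot_step_readings` (letters `κ, o, ν, f`
pairwise distinct; parent `s` with `r = e_κ + e_o + e_ν`, `x^r ∣ F`, `ord₀ F = 6`, `F` clean; real child
`s′ = step 5 univ κ (β·e_f) s` with `x^{r′} ∣ F′`, `ord₀ F′ = 6`, `e_G′ = 3`; parent frame `φ` admissible at `f` with
`coeff_{x_κ} φ = β`, straight (`a ≠ 0`), Tschirnhaus to order `N ≥ 7`; child frame `ψ` admissible, straight,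
Tschirnhaus to order `N`).  For every relative exponent `m` with `3 ≤ |m|`, `m_ν ≤ 3` and `|m♯| ≤ 6`
(`m♯ := m.update κ (|m| − 3)`):  `coeff_{r + m♯} (clean (τ_ψ F′)) = coeff_{r + m} (clean (τ_φ F))`.
[OURS] [cite: CossartJannsenSaito2020, Thm. 3.14] -/
theorem slot_step_relabel {κ o ν f : Fin 4} (hκo : κ ≠ o) (hκν : κ ≠ ν) (hκf : κ ≠ f) (hoν : o ≠ ν)
    (hof : o ≠ f) (hνf : ν ≠ f) {s : State K} {β : K}
    (hr : s.r = Finsupp.single κ 1 + Finsupp.single o 1 + Finsupp.single ν 1)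
    (hdiv : ∀ e ∈ s.F.support, s.r ≤ e) (ho : ordZero s.F = (6 : ℕ)) (hclean : deletePthPowers 5 s.F = s.F)
    (hdiv' : ∀ e ∈ (CentreBlowup.step 5 Finset.univ κ (Pi.single f β) s).F.support,
      (CentreBlowup.step 5 Finset.univ κ (Pi.single f β) s).r ≤ e)
    (ho' : ordZero (CentreBlowup.step 5 Finset.univ κ (Pi.single f β) s).F = (6 : ℕ))
    (he3' : Module.finrank K (resVertex (CentreBlowup.step 5 Finset.univ κ (Pi.single f β) s)) = 3)
    {φ : MvPolynomial (Fin 4) K} (hφ : f ∉ φ.vars) (h0φ : constantCoeff φ = 0)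
    (hφκ : coeff (Finsupp.single κ 1) φ = β) {a : K} (ha : a ≠ 0)
    (hφ3 : homogeneousComponent 3 (tsch f φ (s.F.divMonomial s.r)) = C a * X f ^ 3) {N : ℕ} (hN7 : 7 ≤ N)
    (hφN : ∀ n : Fin 4 →₀ ℕ, n f = 2 → n.degree ≤ N + 2 → coeff n (tsch f φ (s.F.divMonomial s.r)) = 0)
    {ψ : MvPolynomial (Fin 4) K} (hψ : f ∉ ψ.vars) (h0ψ : constantCoeff ψ = 0) {a' : K}
    (hψ3 : homogeneousComponent 3 (tsch f ψ ((CentreBlowup.step 5 Finset.univ κ (Pi.single f β) s).F.divMonomial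
      (CentreBlowup.step 5 Finset.univ κ (Pi.single f β) s).r)) = C a' * X f ^ 3)
    (hψN : ∀ n : Fin 4 →₀ ℕ, n f = 2 → n.degree ≤ N + 2 →
      coeff n (tsch f ψ ((CentreBlowup.step 5 Finset.univ κ (Pi.single f β) s).F.divMonomial
        (CentreBlowup.step 5 Finset.univ κ (Pi.single f β) s).r)) = 0)
    {m : Fin 4 →₀ ℕ} (hm3 : 3 ≤ m.degree) (hmν : m ν ≤ 3) (hm6 : (m.update κ (m.degree - 3)).degree ≤ 6) :
    coeff (s.r + m.update κ (m.degree - 3))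
        (deletePthPowers 5 (tsch f ψ (CentreBlowup.step 5 Finset.univ κ (Pi.single f β) s).F)) =
      coeff (s.r + m) (deletePthPowers 5 (tsch f φ s.F)) := by
  haveI : Fact (Nat.Prime 5) := ⟨by norm_num⟩
  have h3K : (3 : K) ≠ 0 := fun h =>
    absurd ((CharP.cast_eq_zero_iff K 5 3).mp (by exact_mod_cast h)) (by norm_num)
  -- names
  set s' := CentreBlowup.step 5 Finset.univ κ (Pi.single f β) s with hs'
  set G := s.F.divMonomial s.r with hG
  set G' := s'.F.divMonomial s'.r with hG'
  set S : State K := ⟨deletePthPowers 5 (tsch f φ s.F), s.r, s.exc⟩ with hS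
  set T := CentreBlowup.step 5 Finset.univ κ 0 S with hT
  set φ' := translate (0 : Fin 4 → K) (chartTransform 1 Finset.univ κ φ) -
    C (MvPolynomial.eval (0 : Fin 4 → K) (chartTransform 1 Finset.univ κ φ)) with hφ'
  -- basic data
  have hrκ : s.r κ = 1 := by rw [hr]; simp [hκo.symm, hκν.symm]
  have hrf : s.r f = 0 := by rw [hr]; simp [hκf, hof, hνf]
  have hrdeg : s.r.degree = 3 := by rw [hr, map_add, map_add]; simp
  have hq : ((5 : ℕ) : ℕ∞) ≤ ordZero s.F := by rw [ho]; exact_mod_cast (by norm_num : 5 ≤ 6)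
  have hFG : s.F = monomial s.r 1 * G := (monomial_mul_divMonomial hdiv).symm
  have hclean' : deletePthPowers 5 s'.F = s'.F := deletePthPowers_step_F 5 Finset.univ κ _ s
  have hF'G' : s'.F = monomial s'.r 1 * G' := (monomial_mul_divMonomial hdiv').symm
  -- admissibility of the transported datum
  have hφ'v : f ∉ φ'.vars := not_mem_vars_tschShift (not_mem_vars_chartTransform 1 Finset.univ hκf hφ) 0
  have h0φ' : constantCoeff φ' = 0 := constantCoeff_tschShift 0 _
  -- the framed step
  have hTF : T.F = deletePthPowers 5 (tsch f φ' s'.F) := step_zero_framed_F hκf hq h0φ hφκ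
  have hTr : T.r = s'.r := step_zero_framed_r hclean hφ h0φ hrf hφκ
  -- the framed parent `S`
  have hSr : S.r = s.r := rfl
  have hdivS : ∀ e ∈ S.F.support, S.r ≤ e := forall_le_of_mem_support_clean_tsch 5 hrf hdiv
  have hoS : ordZero S.F = (6 : ℕ) := by
    show ordZero (deletePthPowers 5 (tsch f φ s.F)) = _
    rw [ordZero_clean_tsch (p := 5) hφ h0φ hclean, ho]
  have hr' : s'.r = s.r := by
    rw [← hTr, hT, step_zero_r_eq hoS hdivS (by rw [hSr, hrκ])]
  -- readings of `S` on the framed residual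
  have hreadS : ∀ m : Fin 4 →₀ ℕ, ¬ IsPthPowerExponent 5 (s.r + m) →
      coeff (s.r + m) S.F = coeff m (tsch f φ G) := fun m hnp =>
    coeff_clean_tsch_boundary_add 5 φ hrf hFG hnp
  have hG3 : ∀ m : Fin 4 →₀ ℕ, m.degree = 3 → coeff m (tsch f φ G) = coeff m (C a * X f ^ 3) := by
    intro m hm
    rw [← hφ3, coeff_homogeneousComponent, if_pos hm]
  have hcoef3 : ∀ m : Fin 4 →₀ ℕ, m.degree = 3 → m ≠ Finsupp.single f 3 → coeff m (tsch f φ G) = 0 := by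
    intro m hm hne
    rw [hG3 m hm, X_pow_eq_monomial, C_mul_monomial, mul_one, coeff_monomial, if_neg (Ne.symm hne)]
  have haS : coeff (S.r + Finsupp.single f 3) S.F ≠ 0 := by
    rw [hSr, hreadS _ (not_isPthPowerExponent_boundary_add_of_apply hrf (by simp) (by simp)),
      hG3 _ (Finsupp.degree_single f 3), X_pow_eq_monomial, C_mul_monomial, mul_one, coeff_monomial, if_pos rfl]
    exact ha
  have hconeS : ∀ m : Fin 4 →₀ ℕ, m.degree = 3 → m ≠ Finsupp.single f 3 → coeff (S.r + m) S.F = 0 := by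
    intro m hm hne
    have hmν : m ν ≤ 3 := by
      have := Finsupp.le_degree ν m
      omega
    rw [hSr, hreadS _ (not_isPthPowerExponent_boundary_add hκν hoν hr hmν)]
    exact hcoef3 m hm hne
  have hstraightS : ∀ i, i ≠ f → coeff (S.r + (Finsupp.single f 2 + Finsupp.single i 1)) S.F = 0 := by
    intro i hi
    refine hconeS _ (by rw [map_add, Finsupp.degree_single, Finsupp.degree_single]) fun h => ?_
    have := DFunLike.congr_fun h i
    simp [hi] at this
  have htschS : coeff (S.r + (Finsupp.single f 2 + Finsupp.single κ 2)) S.F = 0 := by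
    rw [hSr, hreadS _ (not_isPthPowerExponent_boundary_add_of_apply hrf (by simp [hκf]) (by simp [hκf]))]
    exact hφN _ (by simp [hκf]) (by rw [map_add, Finsupp.degree_single, Finsupp.degree_single]; omega)
  -- the framed child `T` is a re-framing of `s'`
  have hoT : ordZero T.F = (6 : ℕ) := by
    rw [hTF, ordZero_clean_tsch (p := 5) hφ'v h0φ' hclean', ho']
  have hr'f : s'.r f = 0 := by rw [hr', hrf]
  have he3T : Module.finrank K (resVertex T) = 3 := by
    have hTeq : resVertex T = resVertex (⟨deletePthPowers 5 (tsch f φ' s'.F), s'.r, s'.exc⟩ : State K) := by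
      show PointBlowup.additiveSubspace (resForm T) = PointBlowup.additiveSubspace (resForm _)
      unfold resForm
      rw [hTF, hTr]
    rw [hTeq, finrank_resVertex_cleanTschState (p := 5) hφ'v h0φ' hr'f hdiv' ho' (by norm_num), he3']
  -- β5: the child is straight in the transported frame
  obtain ⟨hconeT, hx3T, -, -, -, -, -⟩ := legal_readings_of_corner hκo hκν hκf hoν hof hνf
    (s := S) hr hdivS hoS haS hstraightS htschS hoT he3T
  -- readings of `T` and of the canonical child on the residual `G'`
  have hreadT : ∀ m : Fin 4 →₀ ℕ, ¬ IsPthPowerExponent 5 (s.r + m) →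
      coeff (s.r + m) T.F = coeff m (tsch f φ' G') := fun m hnp => by
    rw [hTF]; rw [← hr'] at hnp ⊢; exact coeff_clean_tsch_boundary_add 5 φ' hr'f hF'G' hnp
  have hreadψ : ∀ m : Fin 4 →₀ ℕ, ¬ IsPthPowerExponent 5 (s.r + m) →
      coeff (s.r + m) (deletePthPowers 5 (tsch f ψ s'.F)) = coeff m (tsch f ψ G') := fun m hnp => by
    rw [← hr'] at hnp ⊢; exact coeff_clean_tsch_boundary_add 5 ψ hr'f hF'G' hnp
  -- the transported frame is straight …
  have haT : coeff (Finsupp.single f 3) (tsch f φ' G') ≠ 0 := by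
    rw [← hreadT _ (not_isPthPowerExponent_boundary_add_of_apply hrf (by simp) (by simp)), ← hSr, hx3T]
    exact haS
  have hφ'3 : homogeneousComponent 3 (tsch f φ' G') = C (coeff (Finsupp.single f 3) (tsch f φ' G')) * X f ^ 3 := by
    refine homogeneousComponent_eq_C_mul_X_pow_of_coeff fun m hm hne => ?_
    have hmν : m ν ≤ 3 := by
      have := Finsupp.le_degree ν m
      omega
    rw [← hreadT _ (not_isPthPowerExponent_boundary_add hκν hoν hr hmν), ← hSr]
    exact hconeT m hm hne
  -- … and Tschirnhaus to order `N - 1`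
  have hSN : ∀ m : Fin 4 →₀ ℕ, m f = 2 → m.degree ≤ N + 2 → coeff (S.r + m) S.F = 0 := by
    intro m hmf hm
    rw [hSr, hreadS _ (not_isPthPowerExponent_boundary_add_of_apply hrf (by omega) (by omega))]
    exact hφN m hmf hm
  have hφ'N : ∀ n : Fin 4 →₀ ℕ, n f = 2 → n.degree ≤ (N - 1) + 2 → coeff n (tsch f φ' G') = 0 := by
    intro n hnf hn
    rw [← hreadT _ (not_isPthPowerExponent_boundary_add_of_apply hrf (by omega) (by omega)), ← hSr]
    exact tsch_order_step_zero hκo hκν hκf hoν hof hνf (S := S) hr hdivS hoS hSN hnf (by omega)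
  have hψN' : ∀ n : Fin 4 →₀ ℕ, n f = 2 → n.degree ≤ (N - 1) + 2 → coeff n (tsch f ψ G') = 0 :=
    fun n hnf hn => hψN n hnf (by omega)
  have hoG' : ((3 : ℕ) : ℕ∞) ≤ ordZero G' := by
    refine (natCast_le_ordZero_iff_forall_coeff G' 3).mpr fun d hd => ?_
    rw [hG', coeff_divMonomial]
    refine coeff_eq_zero_of_degree_lt_ordZero ?_
    rw [ho', map_add, hr', hrdeg]
    exact_mod_cast (by omega : 3 + d.degree < 6)
  -- D4: the two frames of the child agree up to `u`-degree `N - 1`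
  have hD4 : ∀ (m : Fin 4 →₀ ℕ), m.degree ≤ N - 1 → ∀ j : ℕ,
      coeff (m + Finsupp.single f j) (tsch f φ' G') = coeff (m + Finsupp.single f j) (tsch f ψ G') :=
    fun m hm j => coeff_tsch_eq_of_frames h0φ' hφ'v h0ψ hψ (d := 3) (by norm_num) h3K hoG' haT hφ'3 hψ3
      hφ'N hψN' G' hm j
  -- transfer of a reading with `m_ν ≤ 3`, `|m| ≤ 6`
  have htrans : ∀ m : Fin 4 →₀ ℕ, m ν ≤ 3 → m.degree ≤ 6 →
      coeff (s.r + m) (deletePthPowers 5 (tsch f ψ s'.F)) = coeff (s.r + m) T.F := by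
    intro m hmν hm
    have hnp := not_isPthPowerExponent_boundary_add hκν hoν hr hmν
    rw [hreadψ m hnp, hreadT m hnp]
    have h := hD4 m (by omega) 0
    rw [Finsupp.single_zero, add_zero] at h
    exact h.symm
  -- the chart law
  have hν' : (m.update κ (m.degree - 3)) ν ≤ 3 := by
    rw [Finsupp.coe_update, Function.update_of_ne hκν.symm]; exact hmν
  rw [htrans _ hν' hm6]
  exact coeff_step_zero_boundary hκo hκν hoν (s := S) hr
    (by rw [ordAlong_univ, hoS]; exact_mod_cast (by norm_num)) hm3 hmν

/-- `slot_step_relabel` for a relative exponent FIXED by the chart law (`|m| = m_κ + 3`, `m_ν ≤ 3`, `|m| ≤ 6`):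
`coeff_{r + m} (clean (τ_ψ F′)) = coeff_{r + m} (clean (τ_φ F))`. [OURS] [cite: CossartJannsenSaito2020, Thm. 3.14] -/
theorem slot_step_relabel_fixed {κ o ν f : Fin 4} (hκo : κ ≠ o) (hκν : κ ≠ ν) (hκf : κ ≠ f) (hoν : o ≠ ν)
    (hof : o ≠ f) (hνf : ν ≠ f) {s : State K} {β : K}
    (hr : s.r = Finsupp.single κ 1 + Finsupp.single o 1 + Finsupp.single ν 1)
    (hdiv : ∀ e ∈ s.F.support, s.r ≤ e) (ho : ordZero s.F = (6 : ℕ)) (hclean : deletePthPowers 5 s.F = s.F)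
    (hdiv' : ∀ e ∈ (CentreBlowup.step 5 Finset.univ κ (Pi.single f β) s).F.support,
      (CentreBlowup.step 5 Finset.univ κ (Pi.single f β) s).r ≤ e)
    (ho' : ordZero (CentreBlowup.step 5 Finset.univ κ (Pi.single f β) s).F = (6 : ℕ))
    (he3' : Module.finrank K (resVertex (CentreBlowup.step 5 Finset.univ κ (Pi.single f β) s)) = 3)
    {φ : MvPolynomial (Fin 4) K} (hφ : f ∉ φ.vars) (h0φ : constantCoeff φ = 0)
    (hφκ : coeff (Finsupp.single κ 1) φ = β) {a : K} (ha : a ≠ 0)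
    (hφ3 : homogeneousComponent 3 (tsch f φ (s.F.divMonomial s.r)) = C a * X f ^ 3) {N : ℕ} (hN7 : 7 ≤ N)
    (hφN : ∀ n : Fin 4 →₀ ℕ, n f = 2 → n.degree ≤ N + 2 → coeff n (tsch f φ (s.F.divMonomial s.r)) = 0)
    {ψ : MvPolynomial (Fin 4) K} (hψ : f ∉ ψ.vars) (h0ψ : constantCoeff ψ = 0) {a' : K}
    (hψ3 : homogeneousComponent 3 (tsch f ψ ((CentreBlowup.step 5 Finset.univ κ (Pi.single f β) s).F.divMonomial
      (CentreBlowup.step 5 Finset.univ κ (Pi.single f β) s).r)) = C a' * X f ^ 3)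
    (hψN : ∀ n : Fin 4 →₀ ℕ, n f = 2 → n.degree ≤ N + 2 →
      coeff n (tsch f ψ ((CentreBlowup.step 5 Finset.univ κ (Pi.single f β) s).F.divMonomial
        (CentreBlowup.step 5 Finset.univ κ (Pi.single f β) s).r)) = 0)
    {m : Fin 4 →₀ ℕ} (hm : m.degree = m κ + 3) (hmν : m ν ≤ 3) (hm6 : m.degree ≤ 6) :
    coeff (s.r + m) (deletePthPowers 5 (tsch f ψ (CentreBlowup.step 5 Finset.univ κ (Pi.single f β) s).F)) =
      coeff (s.r + m) (deletePthPowers 5 (tsch f φ s.F)) := by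
  have hupd : m.update κ (m.degree - 3) = m := by
    rw [hm, Nat.add_sub_cancel]
    ext i
    rw [Finsupp.coe_update]
    by_cases hi : i = κ
    · subst hi; rw [Function.update_self]
    · rw [Function.update_of_ne hi]
  have h := slot_step_relabel hκo hκν hκf hoν hof hνf hr hdiv ho hclean hdiv' ho' he3' hφ h0φ hφκ ha hφ3 hN7 hφN
    hψ h0ψ hψ3 hψN (m := m) (by omega) hmν (by rw [hupd]; exact hm6)
  rwa [hupd] at h

/-- Instance `x_κx_o³ ↦ x_κx_o³` of `slot_step_relabel_fixed` (the reading `hfix'` of the rotating two-slot game).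
[OURS] [cite: CossartJannsenSaito2020, Thm. 3.14] -/
theorem slot_step_relabel_one_three {κ o ν f : Fin 4} (hκo : κ ≠ o) (hκν : κ ≠ ν) (hκf : κ ≠ f) (hoν : o ≠ ν)
    (hof : o ≠ f) (hνf : ν ≠ f) {s : State K} {β : K}
    (hr : s.r = Finsupp.single κ 1 + Finsupp.single o 1 + Finsupp.single ν 1)
    (hdiv : ∀ e ∈ s.F.support, s.r ≤ e) (ho : ordZero s.F = (6 : ℕ)) (hclean : deletePthPowers 5 s.F = s.F)
    (hdiv' : ∀ e ∈ (CentreBlowup.step 5 Finset.univ κ (Pi.single f β) s).F.support,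
      (CentreBlowup.step 5 Finset.univ κ (Pi.single f β) s).r ≤ e)
    (ho' : ordZero (CentreBlowup.step 5 Finset.univ κ (Pi.single f β) s).F = (6 : ℕ))
    (he3' : Module.finrank K (resVertex (CentreBlowup.step 5 Finset.univ κ (Pi.single f β) s)) = 3)
    {φ : MvPolynomial (Fin 4) K} (hφ : f ∉ φ.vars) (h0φ : constantCoeff φ = 0)
    (hφκ : coeff (Finsupp.single κ 1) φ = β) {a : K} (ha : a ≠ 0)
    (hφ3 : homogeneousComponent 3 (tsch f φ (s.F.divMonomial s.r)) = C a * X f ^ 3) {N : ℕ} (hN7 : 7 ≤ N)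
    (hφN : ∀ n : Fin 4 →₀ ℕ, n f = 2 → n.degree ≤ N + 2 → coeff n (tsch f φ (s.F.divMonomial s.r)) = 0)
    {ψ : MvPolynomial (Fin 4) K} (hψ : f ∉ ψ.vars) (h0ψ : constantCoeff ψ = 0) {a' : K}
    (hψ3 : homogeneousComponent 3 (tsch f ψ ((CentreBlowup.step 5 Finset.univ κ (Pi.single f β) s).F.divMonomial
      (CentreBlowup.step 5 Finset.univ κ (Pi.single f β) s).r)) = C a' * X f ^ 3)
    (hψN : ∀ n : Fin 4 →₀ ℕ, n f = 2 → n.degree ≤ N + 2 →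
      coeff n (tsch f ψ ((CentreBlowup.step 5 Finset.univ κ (Pi.single f β) s).F.divMonomial
        (CentreBlowup.step 5 Finset.univ κ (Pi.single f β) s).r)) = 0) :
    coeff (s.r + (Finsupp.single κ 1 + Finsupp.single o 3))
        (deletePthPowers 5 (tsch f ψ (CentreBlowup.step 5 Finset.univ κ (Pi.single f β) s).F)) =
      coeff (s.r + (Finsupp.single κ 1 + Finsupp.single o 3)) (deletePthPowers 5 (tsch f φ s.F)) :=
  slot_step_relabel_fixed hκo hκν hκf hoν hof hνf hr hdiv ho hclean hdiv' ho' he3' hφ h0φ hφκ ha hφ3 hN7 hφN hψ h0ψ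
    hψ3 hψN (by rw [map_add, Finsupp.degree_single, Finsupp.degree_single]; simp [hκo])
    (by simp [hκν, hoν]) (by rw [map_add, Finsupp.degree_single, Finsupp.degree_single]; norm_num)

/-- Instance `x_fx_κx_o² ↦ x_fx_κx_o²` of `slot_step_relabel_fixed` (the reading `hmuT` of the rotating two-slot game).
[OURS] [cite: CossartJannsenSaito2020, Thm. 3.14] -/
theorem slot_step_relabel_f_one_two {κ o ν f : Fin 4} (hκo : κ ≠ o) (hκν : κ ≠ ν) (hκf : κ ≠ f) (hoν : o ≠ ν)
    (hof : o ≠ f) (hνf : ν ≠ f) {s : State K} {β : K}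
    (hr : s.r = Finsupp.single κ 1 + Finsupp.single o 1 + Finsupp.single ν 1)
    (hdiv : ∀ e ∈ s.F.support, s.r ≤ e) (ho : ordZero s.F = (6 : ℕ)) (hclean : deletePthPowers 5 s.F = s.F)
    (hdiv' : ∀ e ∈ (CentreBlowup.step 5 Finset.univ κ (Pi.single f β) s).F.support,
      (CentreBlowup.step 5 Finset.univ κ (Pi.single f β) s).r ≤ e)
    (ho' : ordZero (CentreBlowup.step 5 Finset.univ κ (Pi.single f β) s).F = (6 : ℕ))
    (he3' : Module.finrank K (resVertex (CentreBlowup.step 5 Finset.univ κ (Pi.single f β) s)) = 3)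
    {φ : MvPolynomial (Fin 4) K} (hφ : f ∉ φ.vars) (h0φ : constantCoeff φ = 0)
    (hφκ : coeff (Finsupp.single κ 1) φ = β) {a : K} (ha : a ≠ 0)
    (hφ3 : homogeneousComponent 3 (tsch f φ (s.F.divMonomial s.r)) = C a * X f ^ 3) {N : ℕ} (hN7 : 7 ≤ N)
    (hφN : ∀ n : Fin 4 →₀ ℕ, n f = 2 → n.degree ≤ N + 2 → coeff n (tsch f φ (s.F.divMonomial s.r)) = 0)
    {ψ : MvPolynomial (Fin 4) K} (hψ : f ∉ ψ.vars) (h0ψ : constantCoeff ψ = 0) {a' : K}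
    (hψ3 : homogeneousComponent 3 (tsch f ψ ((CentreBlowup.step 5 Finset.univ κ (Pi.single f β) s).F.divMonomial
      (CentreBlowup.step 5 Finset.univ κ (Pi.single f β) s).r)) = C a' * X f ^ 3)
    (hψN : ∀ n : Fin 4 →₀ ℕ, n f = 2 → n.degree ≤ N + 2 →
      coeff n (tsch f ψ ((CentreBlowup.step 5 Finset.univ κ (Pi.single f β) s).F.divMonomial
        (CentreBlowup.step 5 Finset.univ κ (Pi.single f β) s).r)) = 0) :
    coeff (s.r + (Finsupp.single f 1 + Finsupp.single κ 1 + Finsupp.single o 2))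
        (deletePthPowers 5 (tsch f ψ (CentreBlowup.step 5 Finset.univ κ (Pi.single f β) s).F)) =
      coeff (s.r + (Finsupp.single f 1 + Finsupp.single κ 1 + Finsupp.single o 2))
        (deletePthPowers 5 (tsch f φ s.F)) :=
  slot_step_relabel_fixed hκo hκν hκf hoν hof hνf hr hdiv ho hclean hdiv' ho' he3' hφ h0φ hφκ ha hφ3 hN7 hφN hψ h0ψ
    hψ3 hψN
    (by
      rw [map_add, map_add, Finsupp.degree_single, Finsupp.degree_single, Finsupp.degree_single]
      simp [hκo, hκf.symm])
    (by simp [hκν, hoν, hνf.symm])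
    (by
      rw [map_add, map_add, Finsupp.degree_single, Finsupp.degree_single, Finsupp.degree_single]
      norm_num)

end Relabel

end ResCone

end Summit.ResolutionOfSingularities.ResolutionOfSingularities.Theorems.PIDim4

end
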